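import Literature.Probability.RandomPlanarGeometry.YangBaxterSAWExcursionJordan
import Literature.Probability.RandomPlanarGeometry.YangBaxterSAWYBE
import HarnessLib

/-!
# Barrier catalogue (SAWScalingLimit): the WOUND-MASS BOUND — the Yang–Baxter vertex defect of ANY boundary root at
ANY plaquette is at most `v(θ)` times the wound mass there

Companion of `PlaquetteWalkRootPlaquetteDefectLaw` (this catalogue: at the ROOT'S OWN plaquette `w` of a hole root
`w.side σ` the modulus of the vertex functional is pinned between `v(θ)·cos(π/8)` and `v(θ)` times the total exterior
weight of the WOUND class-`B2a` walks — `vertexFunctional_printed_root_plaquette_defect_law`,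
`norm_vertexFunctional_printed_root_plaquette_le`; Lemma E `norm_backBracket`: every backward half-bracket has modulus
`v(θ)`), of `PlaquetteWalkHoleRootFarCellLaw` (the FAR-CELL LAW `VF = i·v(θ)·(M_N − M_S)`) and of
`YangBaxterSAWUnwoundPlaquette` (topic `RandomPlanarGeometry`: `VF_D(a, f₀) = e^{−i5κ(a)/8}·i·Σ_{B2a(f₀)} classTerm`,
`classTerm = extWeight·phase(WP)·sin((5/8)(WE − excursionWinding))·backBracket`).

This file records the UPPER half of the root-plaquette law at EVERY plaquette and for EVERY non-interior root (outer or
on a hole boundary), with the same constant and no hypothesis on the domain: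

* `ΩG.woundMassAt θ hr ω` — the exterior weight of a class-`B2a` walk at `r` if it is WOUND
  (`WE ≠ excursionWinding(θ; z₀, z₁, z₂)`), else `0` (the general-plaquette form of the catalogue's `woundMass`);
* `ΩG.norm_classTerm_le_woundMassAt` — `‖classTerm‖ ≤ v(θ)·woundMassAt` for every walk (unwound ⇒ the sine vanishes;
  wound ⇒ `|sin| ≤ 1`, `|phase| = 1`, `|backBracket| = v(θ)` — the catalogue's Lemma E, re-derived here as a private twin
  from the topic's twelve closed forms because `PlaquetteWalkRootPlaquetteDefectLaw`'s compiled interface is older than its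
  source at the time of writing);
* ★★ `PlaquetteWalk.norm_vertexFunctional_printed_le_woundMass` — for every `θ ∈ [π/3, 2π/3]`, every finite face list
  `Dl`, every non-interior root `a` and every `f₀ ∈ Dl`:
  **`‖VF_D(a, f₀)‖ ≤ v(θ) · Σ_{ω ∈ B2a(f₀)} woundMassAt θ ω`.**
  So the defect of any root at any plaquette is carried by the wound excursions there, each with efficiency at most the
  straight-arc weight `v(θ)`; no wound mass, no defect (the topic's `…_eq_zero_of_unwoundAt` is the case of zero mass),
  and at the far cell of a hole root the bound reads `v·|M_N − M_S| ≤ v·(M_N + M_S)` (FAR-CELL LAW). By the companion's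
  sign law every wound group has modulus EXACTLY `v(θ)·extWeight` — the bound is an equality of moduli term by term, and
  all cancellation in `VF` is cancellation of DIRECTIONS (venture lane «pcv-sawmu»: the class directions at the seven
  ring cells of a hole are rigid per (cell, first side) in exact enumeration — 621 980 wound walks on 148 ring cells of 31
  domains, no exception — and never span a one-signed cone there, unlike at the root's own plaquette).

References, as printed: A. Glazman, I. Manolescu, arXiv:1708.00395v3, Lemma 2.1 («in the form given in [Gl]») and §1
eq. (1) (the weights) [GlazmanManolescu2019]; A. Glazman, Electron. Commun. Probab. 20 (2015) no. 86, Lemma 3.1 and its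
proof pp. 6–7 (the classes of walks through a rhombus) [Glazman2015WeightedSAW]; H. Duminil-Copin, S. Smirnov, Ann. of
Math. 175 (2012), proof of Lemma 1 (the winding bookkeeping) [DuminilCopinSmirnov2012]. Status: LANE COROLLARY (S) of the
catalogue's Lemma E and the topic's defect localisation; not located in print (hole roots are outside the printed simply
connected setting). Written for the venture lane «pcv-sawmu» (Tier B, b-step0 gen 18).
-/

noncomputable section

namespace Literature.Probability.RandomPlanarGeometry.SAW.YangBaxter

open Real Complex

/-- Reversing the excursion negates the backward half-bracket (twin of the catalogue's `backBracket_swap`; the topic's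
`groupTwo_gen` with `excursionWinding_swap`). [cite: GlazmanManolescu2019, Lemma 2.1 (statement, "in the form given in [Gl]")]
[cite: Glazman2015WeightedSAW, Lemma 3.1 (proof, p. 6)] -/
private theorem backBracket_swap_W (θ : ℝ) {z₀ z₁ z₂ z₃ : Side} (h01 : z₀ ≠ z₁) (h02 : z₀ ≠ z₂) (h03 : z₀ ≠ z₃)
    (h12 : z₁ ≠ z₂) (h13 : z₁ ≠ z₃) (h23 : z₂ ≠ z₃) :
    backBracket θ z₀ z₂ z₁ z₃ = -backBracket θ z₀ z₁ z₂ z₃ := by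
  have h0 := groupTwo_gen θ z₀ z₁ z₂ z₃ h01 h02 h03 h12 h13 h23
  unfold bracket at h0
  unfold backBracket
  rw [excursionWinding_swap θ z₀ z₁ z₂, sub_neg_eq_add]
  linear_combination h0

/-- Every backward half-bracket has modulus `v(θ)` on the printed range, all 24 ordered classes (twin of the catalogue's
Lemma E `norm_backBracket` in `PlaquetteWalkRootPlaquetteDefectLaw`, from the topic's twelve closed forms
`backBracket_W_S_N_E`, … and `backBracket_swap_W`). [cite: GlazmanManolescu2019, Lemma 2.1 (statement) and eq. (1) (the weights)]
[cite: Glazman2015WeightedSAW, Lemma 3.1 (proof, p. 6)] -/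
private theorem norm_backBracket_W {θ : ℝ} (hθ : θ ∈ Set.Icc (π / 3) (2 * π / 3)) {σ z₁ z₂ z₃ : Side} (h01 : σ ≠ z₁)
    (h02 : σ ≠ z₂) (h03 : σ ≠ z₃) (h12 : z₁ ≠ z₂) (h13 : z₁ ≠ z₃) (h23 : z₂ ≠ z₃) :
    ‖backBracket θ σ z₁ z₂ z₃‖ = weightV θ := by
  have hv := weightV_nonneg hθ
  have habs : ‖(weightV θ : ℂ)‖ = weightV θ := by rw [Complex.norm_real, Real.norm_eq_abs, abs_of_nonneg hv]
  have hE : ∀ x : ℝ, ‖Complex.exp ((x : ℂ) * Complex.I)‖ = 1 := fun x => Complex.norm_exp_ofReal_mul_I x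
  revert h01 h02 h03 h12 h13 h23
  cases σ <;> cases z₁ <;> cases z₂ <;> cases z₃ <;> intro h01 h02 h03 h12 h13 h23 <;>
    (try exact absurd rfl h01) <;> (try exact absurd rfl h02) <;> (try exact absurd rfl h03) <;>
    (try exact absurd rfl h12) <;> (try exact absurd rfl h13) <;> (try exact absurd rfl h23)
  case W.E.S.N =>
    rw [backBracket_W_E_S_N]
    simp only [norm_mul, norm_neg, Complex.norm_I, habs, hE, one_mul, mul_one]
  case W.E.N.S =>
    rw [backBracket_W_E_N_S]
    simp only [norm_mul, Complex.norm_I, habs, hE, one_mul, mul_one]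
  case W.S.E.N =>
    rw [backBracket_swap_W θ (z₀ := .W) (z₁ := .E) (z₂ := .S) (z₃ := .N) (by decide) (by decide) (by decide)
      (by decide) (by decide) (by decide), norm_neg, backBracket_W_E_S_N]
    simp only [norm_mul, norm_neg, Complex.norm_I, habs, hE, one_mul, mul_one]
  case W.S.N.E =>
    rw [backBracket_W_S_N_E]
    simp only [norm_mul, Complex.norm_I, habs, one_mul]
  case W.N.E.S =>
    rw [backBracket_swap_W θ (z₀ := .W) (z₁ := .E) (z₂ := .N) (z₃ := .S) (by decide) (by decide) (by decide)
      (by decide) (by decide) (by decide), norm_neg, backBracket_W_E_N_S]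
    simp only [norm_mul, Complex.norm_I, habs, hE, one_mul, mul_one]
  case W.N.S.E =>
    rw [backBracket_swap_W θ (z₀ := .W) (z₁ := .S) (z₂ := .N) (z₃ := .E) (by decide) (by decide) (by decide)
      (by decide) (by decide) (by decide), norm_neg, backBracket_W_S_N_E]
    simp only [norm_mul, Complex.norm_I, habs, one_mul]
  case E.W.S.N =>
    rw [backBracket_swap_W θ (z₀ := .E) (z₁ := .S) (z₂ := .W) (z₃ := .N) (by decide) (by decide) (by decide)
      (by decide) (by decide) (by decide), norm_neg, backBracket_E_S_W_N]
    simp only [norm_mul, norm_neg, habs, hE, mul_one]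
  case E.W.N.S =>
    rw [backBracket_swap_W θ (z₀ := .E) (z₁ := .N) (z₂ := .W) (z₃ := .S) (by decide) (by decide) (by decide)
      (by decide) (by decide) (by decide), norm_neg, backBracket_E_N_W_S]
    simp only [norm_mul, habs, hE, mul_one]
  case E.S.W.N =>
    rw [backBracket_E_S_W_N]
    simp only [norm_mul, norm_neg, habs, hE, mul_one]
  case E.S.N.W =>
    rw [backBracket_swap_W θ (z₀ := .E) (z₁ := .N) (z₂ := .S) (z₃ := .W) (by decide) (by decide) (by decide)
      (by decide) (by decide) (by decide), norm_neg, backBracket_E_N_S_W]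
    simp only [norm_neg, norm_mul, Complex.norm_I, habs, one_mul]
  case E.N.W.S =>
    rw [backBracket_E_N_W_S]
    simp only [norm_mul, habs, hE, mul_one]
  case E.N.S.W =>
    rw [backBracket_E_N_S_W]
    simp only [norm_neg, norm_mul, Complex.norm_I, habs, one_mul]
  case S.W.E.N =>
    rw [backBracket_S_W_E_N]
    simp only [norm_mul, norm_neg, Complex.norm_I, habs, hE, one_mul, mul_one]
  case S.W.N.E =>
    rw [backBracket_S_W_N_E]
    simp only [norm_mul, norm_neg, habs, hE, mul_one]
  case S.E.W.N =>
    rw [backBracket_swap_W θ (z₀ := .S) (z₁ := .W) (z₂ := .E) (z₃ := .N) (by decide) (by decide) (by decide)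
      (by decide) (by decide) (by decide), norm_neg, backBracket_S_W_E_N]
    simp only [norm_mul, norm_neg, Complex.norm_I, habs, hE, one_mul, mul_one]
  case S.E.N.W =>
    rw [backBracket_S_E_N_W]
    simp only [norm_mul, habs, hE, mul_one]
  case S.N.W.E =>
    rw [backBracket_swap_W θ (z₀ := .S) (z₁ := .W) (z₂ := .N) (z₃ := .E) (by decide) (by decide) (by decide)
      (by decide) (by decide) (by decide), norm_neg, backBracket_S_W_N_E]
    simp only [norm_mul, norm_neg, habs, hE, mul_one]
  case S.N.E.W =>
    rw [backBracket_swap_W θ (z₀ := .S) (z₁ := .E) (z₂ := .N) (z₃ := .W) (by decide) (by decide) (by decide)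
      (by decide) (by decide) (by decide), norm_neg, backBracket_S_E_N_W]
    simp only [norm_mul, habs, hE, mul_one]
  case N.W.E.S =>
    rw [backBracket_swap_W θ (z₀ := .N) (z₁ := .E) (z₂ := .W) (z₃ := .S) (by decide) (by decide) (by decide)
      (by decide) (by decide) (by decide), norm_neg, backBracket_N_E_W_S]
    simp only [norm_mul, Complex.norm_I, habs, hE, one_mul, mul_one]
  case N.W.S.E =>
    rw [backBracket_N_W_S_E]
    simp only [norm_mul, norm_neg, habs, hE, mul_one]
  case N.E.W.S =>
    rw [backBracket_N_E_W_S]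
    simp only [norm_mul, Complex.norm_I, habs, hE, one_mul, mul_one]
  case N.E.S.W =>
    rw [backBracket_N_E_S_W]
    simp only [norm_mul, habs, hE, mul_one]
  case N.S.W.E =>
    rw [backBracket_swap_W θ (z₀ := .N) (z₁ := .W) (z₂ := .S) (z₃ := .E) (by decide) (by decide) (by decide)
      (by decide) (by decide) (by decide), norm_neg, backBracket_N_W_S_E]
    simp only [norm_mul, norm_neg, habs, hE, mul_one]
  case N.S.E.W =>
    rw [backBracket_swap_W θ (z₀ := .N) (z₁ := .E) (z₂ := .S) (z₃ := .W) (by decide) (by decide) (by decide)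
      (by decide) (by decide) (by decide), norm_neg, backBracket_N_E_S_W]
    simp only [norm_mul, habs, hE, mul_one]

namespace ΩG

variable {D : Set Face} {a : MidEdge} {r : Face}

open Classical in
/-- **The wound mass of a walk at a plaquette**: its exterior weight if it is of class `B2a` and WOUND
(`WE ≠ excursionWinding(θ; z₀, z₁, z₂)`), else `0` — the general-plaquette form of the catalogue's `woundMass` (root
plaquette) and the sum of the far-cell law's two route masses at the far cell.
[cite: GlazmanManolescu2019, Lemma 2.1 (statement, "in the form given in [Gl]")] [cite: Glazman2015WeightedSAW, Lemma 3.1 (proof, pp. 6–7)] -/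
noncomputable def woundMassAt (θ : ℝ) (hr : RootedFace D a r) (ω : ΩG D a r) : ℝ :=
  if h : ω.IsB2a then
    (if ω.WE (fun _ => θ) ≠ excursionWinding θ ω.2.firstSideG (ω.z1 hr h) ω.1 then ω.2.extWeight (fun _ => θ) r
      else 0)
  else 0

/-- Wound masses are non-negative on the printed range. [cite: GlazmanManolescu2019, eq. (1) (the weights are non-negative)] -/
theorem woundMassAt_nonneg {θ : ℝ} (hθ : θ ∈ Set.Icc (π / 3) (2 * π / 3)) (hr : RootedFace D a r) (ω : ΩG D a r) :
    0 ≤ woundMassAt θ hr ω := by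
  unfold woundMassAt
  split_ifs
  · exact Finset.prod_nonneg fun _ _ => localWeight_nonneg hθ _
  · exact le_rfl
  · exact le_rfl

/-- The wound mass is at most the exterior weight. [cite: GlazmanManolescu2019, eq. (1) (the weights are non-negative)] -/
theorem woundMassAt_le_extWeight {θ : ℝ} (hθ : θ ∈ Set.Icc (π / 3) (2 * π / 3)) (hr : RootedFace D a r)
    (ω : ΩG D a r) : woundMassAt θ hr ω ≤ ω.2.extWeight (fun _ => θ) r := by
  have hext : 0 ≤ ω.2.extWeight (fun _ => θ) r := Finset.prod_nonneg fun _ _ => localWeight_nonneg hθ _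
  unfold woundMassAt
  split_ifs
  · exact le_rfl
  · exact hext
  · exact hext

/-- ★ **Per-walk bound at any plaquette, for any root**: `‖classTerm‖ ≤ v(θ)·woundMassAt` — an unwound walk's group
vanishes (`sin 0 = 0`), a wound one has `|sin| ≤ 1`, `|phase(WP)| = 1`, `|backBracket| = v(θ)`.
[cite: GlazmanManolescu2019, Lemma 2.1 (statement, "in the form given in [Gl]")] [cite: Glazman2015WeightedSAW, Lemma 3.1 (proof, pp. 6–7)] -/
theorem norm_classTerm_le_woundMassAt {θ : ℝ} (hθ : θ ∈ Set.Icc (π / 3) (2 * π / 3)) (ω : ΩG D a r)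
    (hr : RootedFace D a r) : ‖ω.classTerm (fun _ => θ) hr‖ ≤ weightV θ * woundMassAt θ hr ω := by
  unfold woundMassAt classTerm
  by_cases h : ω.IsB2a
  · rw [dif_pos h, dif_pos h]
    have hd := ω.2.sides_distinctG hr h.1
    rw [ω.returnSide_of_isB2a h] at hd
    have h3 := ω.z₃_spec hr h
    have hext : 0 ≤ ω.2.extWeight (fun _ => θ) r := Finset.prod_nonneg fun _ _ => localWeight_nonneg hθ _
    have hv : 0 ≤ weightV θ := weightV_nonneg hθ
    by_cases hW : ω.WE (fun _ => θ) ≠ excursionWinding θ ω.2.firstSideG (ω.z1 hr h) ω.1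
    · rw [if_pos hW]
      have hsin : ‖((Real.sin (5 / 8 * (ω.WE (fun _ => θ) -
          excursionWinding θ ω.2.firstSideG (ω.2.exitSideG hr (ω.fh_lt h)) ω.1)) : ℝ) : ℂ)‖ ≤ 1 := by
        rw [Complex.norm_real, Real.norm_eq_abs]; exact Real.abs_sin_le_one _
      have hbb : ‖backBracket θ ω.2.firstSideG (ω.2.exitSideG hr (ω.fh_lt h)) ω.1 (ω.z₃ hr h)‖ = weightV θ :=
        norm_backBracket_W hθ (fun e => hd.1 e.symm) (fun e => hd.2.1 e.symm) (fun e => h3.1 e.symm) (fun e => hd.2.2 e.symm)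
          (fun e => h3.2.1 e.symm) (fun e => h3.2.2 e.symm)
      calc ‖(ω.2.extWeight (fun _ => θ) r : ℂ) * phase (ω.WP fun _ => θ) *
              (Real.sin (5 / 8 * (ω.WE (fun _ => θ) -
                excursionWinding θ ω.2.firstSideG (ω.2.exitSideG hr (ω.fh_lt h)) ω.1)) : ℂ) *
              backBracket θ ω.2.firstSideG (ω.2.exitSideG hr (ω.fh_lt h)) ω.1 (ω.z₃ hr h)‖
          = ω.2.extWeight (fun _ => θ) r * ‖((Real.sin (5 / 8 * (ω.WE (fun _ => θ) -
              excursionWinding θ ω.2.firstSideG (ω.2.exitSideG hr (ω.fh_lt h)) ω.1)) : ℝ) : ℂ)‖ * weightV θ := by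
            rw [norm_mul, norm_mul, norm_mul, Complex.norm_real, Real.norm_eq_abs, abs_of_nonneg hext, phase,
              Complex.norm_exp_ofReal_mul_I, mul_one, hbb]
        _ ≤ ω.2.extWeight (fun _ => θ) r * 1 * weightV θ := by gcongr
        _ = weightV θ * ω.2.extWeight (fun _ => θ) r := by ring
    · rw [if_neg hW, mul_zero]
      have hW' : ω.WE (fun _ => θ) = excursionWinding θ ω.2.firstSideG (ω.z1 hr h) ω.1 := not_not.1 hW
      unfold ΩG.z1 at hW'
      rw [hW', sub_self, mul_zero, Real.sin_zero]
      simp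
  · rw [dif_neg h, dif_neg h, norm_zero, mul_zero]

end ΩG

end Literature.Probability.RandomPlanarGeometry.SAW.YangBaxter

namespace Literature.Barriers.CriticalPhenomena.PlaquetteWalk

open Literature.Probability.RandomPlanarGeometry.SAW.YangBaxter
open Real Complex

/-- ★★ **THE WOUND-MASS BOUND AT EVERY PLAQUETTE.** For every `θ ∈ [π/3, 2π/3]`, every finite face list `Dl`,
every non-interior root `a` (at most one of its two faces in the domain — outer or hole boundary) and every
plaquette `f₀ ∈ Dl`: `‖VF_D(a, f₀)‖ ≤ v(θ) · Σ_{ω ∈ B2a(f₀)} woundMassAt ω`.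
[cite: GlazmanManolescu2019, Lemma 2.1 (statement, "in the form given in [Gl]")]
[cite: Glazman2015WeightedSAW, Lemma 3.1 (proof, pp. 6–7: the classes of walks through a rhombus)] [cite: DuminilCopinSmirnov2012, proof of Lemma 1] -/
theorem norm_vertexFunctional_printed_le_woundMass {θ : ℝ} (hθ : θ ∈ Set.Icc (π / 3) (2 * π / 3))
    (Dl : List Face) (a : MidEdge) (ha : ¬(a.faces.1 ∈ dom Dl ∧ a.faces.2 ∈ dom Dl)) (f₀ : Face) (hf : f₀ ∈ Dl) :
    ‖vertexFunctional (printedWeights θ) tFiveEighths (ybCoeff θ) Dl a f₀‖ ≤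
      weightV θ * ∑ ω ∈ ΩG.setB2a (dom Dl) a f₀, ΩG.woundMassAt θ ⟨hf, ha⟩ ω := by
  rw [vertexFunctional_printed_eq_phase_mul_lem21Defect, ← ΩG.sum_g_eq_lem21Defect,
    ΩG.sum_g_eq_I_mul_sum_classTerm (fun _ => θ) ⟨hf, ha⟩ (fun _ => hθ), norm_mul, norm_mul,
    Complex.norm_exp_ofReal_mul_I, Complex.norm_I, one_mul, one_mul, Finset.mul_sum]
  exact (norm_sum_le _ _).trans (Finset.sum_le_sum fun ω _ => ΩG.norm_classTerm_le_woundMassAt hθ ω _)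

/-- ★ **Corollary: the defect is at most `v(θ)` times the total exterior weight of ALL class-`B2a` walks at the
plaquette** (wound or not). [cite: GlazmanManolescu2019, Lemma 2.1 (statement, "in the form given in [Gl]")] [cite: Glazman2015WeightedSAW, Lemma 3.1 (proof, pp. 6–7)] -/
theorem norm_vertexFunctional_printed_le_extWeight {θ : ℝ} (hθ : θ ∈ Set.Icc (π / 3) (2 * π / 3))
    (Dl : List Face) (a : MidEdge) (ha : ¬(a.faces.1 ∈ dom Dl ∧ a.faces.2 ∈ dom Dl)) (f₀ : Face) (hf : f₀ ∈ Dl) :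
    ‖vertexFunctional (printedWeights θ) tFiveEighths (ybCoeff θ) Dl a f₀‖ ≤
      weightV θ * ∑ ω ∈ ΩG.setB2a (dom Dl) a f₀, ω.2.extWeight (fun _ => θ) f₀ := by
  refine (norm_vertexFunctional_printed_le_woundMass hθ Dl a ha f₀ hf).trans ?_
  exact mul_le_mul_of_nonneg_left
    (Finset.sum_le_sum fun ω _ => ΩG.woundMassAt_le_extWeight hθ ⟨hf, ha⟩ ω) (weightV_nonneg hθ)

end Literature.Barriers.CriticalPhenomena.PlaquetteWalk
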